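import Summits.Parity.GeneralizedHardyLittlewood.Theses.GreenTaoLevelTwo
import Summits.Parity.GeneralizedHardyLittlewood.Theorems.GreenTaoLevelTwoMNTwoVerticalReductionBookkeeping
import Summits.Parity.GeneralizedHardyLittlewood.Theorems.GreenTaoLevelTwoMNTwoCentralFrames
import Summits.Parity.GeneralizedHardyLittlewood.Theorems.GreenTaoLevelTwoMNTwoVerticalHapprox
import HarnessLib

/-!
# Route `GreenTaoLevelTwo`, crux `MNTwo` (stmt-Parity-21276), line `birth`: the vertical-reduction
# stub `stub_verticalReduction` — Green–Tao 2012a Lemma 3.7, BY NAME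

The registered stub of the `MNTwo` birth skeleton, with its signature spelled out: the
VERTICAL-CHARACTER case of `MN(2)` with polynomial dependence on the Lipschitz constant over the
whole Heisenberg class (`stub_mnVertical`, the XL stub = Green–Tao 2008b AIF Thm. 1.1 /
Green–Tao 2012a Thm. 1.1 for vertical characters, taken here as the HYPOTHESIS) implies the route
crux `MNTwo` (`MN(2)` for every `1`-bounded `M`-Lipschitz `F` on every `X^m × ℝ/ℤ`,
`X ∈ 𝒞₂(H_d)`, every Def-8.1 box-comparable `d`).

Proof (Green–Tao 2012a, Lemma 3.7 and §3, all layers landed in this directory):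
* `…MNTwoCentralFrames.centralFrame_verticalClass`: every `X^m × ℝ/ℤ` carries a central frame
  `ι : ℝ^I ↠ Z(G)` (continuous homomorphism onto the centre, `ι(ℤ^I) ⊆ Γ`, translations
  `L`-Lipschitz, displacement `≤ L‖t‖`);
* `…MNTwoVerticalHapprox.happrox_of_frame`: along such a frame every `1`-bounded `M`-Lipschitz
  `F` is uniformly within `ε` of `≤ Φ(M)/ε^D` vertical characters with Lipschitz constants `L³M`
  (vertical Fourier expansion on `(ℝ/ℤ)^I` — Mathlib's `UnitAddTorus` theory — after a double
  box smoothing along the centre; `…VerticalComponents`, `…VerticalSmoothing`,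
  `…VerticalMultiplier`, `…VerticalTruncation`, `…VerticalWeights(Explicit)`,
  `…VerticalApproximation`);
* `…MNTwoVerticalReductionBookkeeping.mnAt_of_verticalPoly_of_approx`: with `ε = log^(-A) N` and
  the vertical bound at saving `A (D+1)` this gives `MN(2)` for every fixed `M` and every `A`.

References: B. Green, T. Tao, *The Möbius function is strongly orthogonal to nilsequences*,
Ann. of Math. 175 (2012), 541–566, Lemma 3.7, §3 [GreenTao2012Mobius]; B. Green, T. Tao,
*Quadratic uniformity of the Möbius function*, Ann. Inst. Fourier 58 (2008), Thm. 1.1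
[GreenTao2008QuadraticMobius]; B. Green, T. Tao, *Linear equations in primes*, Ann. of Math. 171
(2010), Conj. 8.5 [GreenTao2010].
-/

noncomputable section

open Literature.NumberTheory.Sieve
open Literature.NumberTheory.Sieve.GreenTaoLevelTwo (HX IsCompatMetric IsBoxComparable heisenbergWith
  InHeisClass)
open Summit.Parity.GeneralizedHardyLittlewood.GreenTaoLevelTwoMNTwoVerticalReduction
open Summit.Parity.GeneralizedHardyLittlewood.GreenTaoLevelTwoMNTwoCentralFrames
open Summit.Parity.GeneralizedHardyLittlewood.GreenTaoLevelTwoMNTwoVerticalHapprox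

namespace Summit.Parity.GeneralizedHardyLittlewood.GreenTaoLevelTwoMNTwoVerticalReductionStub

/-- **Stub `stub_verticalReduction` of crux `MNTwo` (line `birth`), by name** — Green–Tao 2012a
Lemma 3.7: `MN(2)` for vertical characters with polynomial Lipschitz dependence, over the whole
Heisenberg class (the hypothesis, = stub `stub_mnVertical` spelled out), implies the route crux
`MNTwo`. [cite: GreenTao2012Mobius, Lemma 3.7 and §3] -/
theorem stub_verticalReduction :
    (∀ (d : HX → HX → ℝ) (h : IsCompatMetric d), IsBoxComparable d →
      ∀ X : Nilmanifold 2, InHeisClass (heisenbergWith d h) X → ∀ m : ℕ,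
        ∀ A : ℝ, 0 < A → ∃ C B : ℝ, ∀ M : ℝ, 1 ≤ M → ∀ N : ℕ, 2 ≤ N →
          ∀ (g : ((X.pow m).prod (Nilmanifold.circle.ofLE one_le_two)).G) (x : ((X.pow m).prod (Nilmanifold.circle.ofLE one_le_two)).G ⧸ ((X.pow m).prod (Nilmanifold.circle.ofLE one_le_two)).Γ) (F₁ F₂ : ((X.pow m).prod (Nilmanifold.circle.ofLE one_le_two)).G ⧸ ((X.pow m).prod (Nilmanifold.circle.ofLE one_le_two)).Γ → ℝ),
            ((X.pow m).prod (Nilmanifold.circle.ofLE one_le_two)).IsBoundedLipschitz M F₁ → ((X.pow m).prod (Nilmanifold.circle.ofLE one_le_two)).IsBoundedLipschitz M F₂ →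
            (∃ θ : ((X.pow m).prod (Nilmanifold.circle.ofLE one_le_two)).G → ℝ, ∀ z : ((X.pow m).prod (Nilmanifold.circle.ofLE one_le_two)).G, z ∈ Subgroup.center ((X.pow m).prod (Nilmanifold.circle.ofLE one_le_two)).G →
              ∀ x : ((X.pow m).prod (Nilmanifold.circle.ofLE one_le_two)).G ⧸ ((X.pow m).prod (Nilmanifold.circle.ofLE one_le_two)).Γ,
                ((F₁ (z • x) : ℂ) + (F₂ (z • x) : ℂ) * Complex.I) =
                  Complex.exp (2 * Real.pi * Complex.I * θ z) * ((F₁ x : ℂ) + (F₂ x : ℂ) * Complex.I)) →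
              ‖∑ n ∈ Finset.Icc 1 N, ((ArithmeticFunction.moebius n : ℝ) : ℂ) *
                  ((F₁ (g ^ n • x) : ℂ) + (F₂ (g ^ n • x) : ℂ) * Complex.I)‖ ≤
                C * M ^ B * N / Real.log N ^ A) →
      Summit.Parity.GeneralizedHardyLittlewood.Theses.GreenTaoLevelTwo.MNTwo := by
  intro hV d h hd X hX m M₀
  obtain ⟨I, instI, ι, L, hL, hadd, hcen, hsurj, hΓ, hcont, hlip, hself⟩ :=
    centralFrame_verticalClass d h hd X hX m
  classical
  obtain ⟨D, Φ, Λ, happ⟩ := happrox_of_frame ((X.pow m).prod (Nilmanifold.circle.ofLE one_le_two)) ι hadd hcen hsurj hΓ hcont hL hlip hself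
  exact mnAt_of_verticalPoly_of_approx ((X.pow m).prod (Nilmanifold.circle.ofLE one_le_two))
    (fun F₁ F₂ => (∃ θ : ((X.pow m).prod (Nilmanifold.circle.ofLE one_le_two)).G → ℝ, ∀ z : ((X.pow m).prod (Nilmanifold.circle.ofLE one_le_two)).G, z ∈ Subgroup.center ((X.pow m).prod (Nilmanifold.circle.ofLE one_le_two)).G →
              ∀ x : ((X.pow m).prod (Nilmanifold.circle.ofLE one_le_two)).G ⧸ ((X.pow m).prod (Nilmanifold.circle.ofLE one_le_two)).Γ,
                ((F₁ (z • x) : ℂ) + (F₂ (z • x) : ℂ) * Complex.I) =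
                  Complex.exp (2 * Real.pi * Complex.I * θ z) * ((F₁ x : ℂ) + (F₂ x : ℂ) * Complex.I)))
    (hV d h hd X hX m) D Φ Λ happ M₀

end Summit.Parity.GeneralizedHardyLittlewood.GreenTaoLevelTwoMNTwoVerticalReductionStub
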